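import Mathlib
import Summits.Ventures.PercRepro2.MergedUnionPA

/-!
# BHK06 Theorem 1.5 by the Gibbs-chain method (blind cell PercRepro2, mine-1 g34)

With `X = ∅` the union event is the sure event and the merged clusters are the plain clusters, so
`merged_union_pa` specialises to the cell's `BHKPair.bhk_pair` (BHK06 Theorem 1.5: the pair
`(C_s, V ∖ C_t)` is positively associated given `s ↮ t`) — proved here by the §2 Markov-chain
route (product fibres, coalescence at `t`, stationarity), without Theorem 1.1 / 1.3 and without
the four-function induction, under the Doeblin hypothesis that every edge at `t` has weight `< 1`.
-/

namespace Summit.Ventures.PercRepro2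

namespace MergedU

section BHK

variable {V : Type*} {E : Type*} [Fintype E] [DecidableEq E] [Fintype V] [DecidableEq V]
  {R : Type*} [Field R] [LinearOrder R] [IsStrictOrderedRing R] [Archimedean R]
  {p : E → R} (ends : E → Sym2 V) (s t : V)

omit [Fintype E] [DecidableEq E] [Fintype V] [DecidableEq V] in
/-- With `X = ∅` the merged cluster of `s` is its cluster. -/
lemma merged_empty_left (ω : Config E) (Y : Set V) : merged ends ω s ∅ Y = cluster ends ω s :=
  merged_eq_cluster_of_not_conn Y (by rintro ⟨x, hx, _⟩; exact hx)

omit [Fintype E] [DecidableEq E] [Fintype V] [DecidableEq V] in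
/-- With `X = ∅` nothing is merged into the cluster of `t` either. -/
lemma merged_empty_right (ω : Config E) (Y : Set V) : merged ends ω t Y ∅ = cluster ends ω t := by
  ext v
  simp only [mem_merged, mem_cluster]
  constructor
  · rintro (hv | ⟨_, x, hx, _⟩)
    · exact hv
    · exact hx.elim
  · exact Or.inl

omit [Fintype E] [DecidableEq E] [Fintype V] [DecidableEq V] in
/-- `{t ∉ C_s} = {s ↮ t}`. -/
lemma setOf_notMem_cluster_eq : {ω : Config E | t ∉ cluster ends ω s} = (connEvent ends s t)ᶜ := by
  ext ω
  simp only [Set.mem_setOf_eq, mem_cluster, Set.mem_compl_iff, mem_connEvent]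

omit [DecidableEq V] in
/-- **BHK06 Theorem 1.5 by the chain** (the statement of `BHKPair.bhk_pair`, with the Doeblin
hypothesis `p e < 1` at `t` and bounded functionals): for nonnegative `F, G ≤ M` increasing in
`C_s` and decreasing in `C_t`,
`E[F(C_s,C_t) 1_Q] · E[G(C_s,C_t) 1_Q] ≤ E[(F G)(C_s,C_t) 1_Q] · P(Q)`, `Q = {s ↮ t}`. -/
theorem bhk_pair_of_chain (hp : IsProbVec p) (hpt : ∀ e ∈ touches ends {t}, p e < 1)
    {F G : Set V → Set V → R}
    (hF : ∀ ⦃W W' C C' : Set V⦄, W ⊆ W' → C' ⊆ C → F W C ≤ F W' C')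
    (hG : ∀ ⦃W W' C C' : Set V⦄, W ⊆ W' → C' ⊆ C → G W C ≤ G W' C')
    (hF0 : ∀ W C, 0 ≤ F W C) (hG0 : ∀ W C, 0 ≤ G W C) {M : R} (hFM : ∀ W C, F W C ≤ M)
    (hGM : ∀ W C, G W C ≤ M) :
    expect p (fun ω => F (cluster ends ω s) (cluster ends ω t) *
        ((connEvent ends s t)ᶜ).indicator 1 ω) *
      expect p (fun ω => G (cluster ends ω s) (cluster ends ω t) *
        ((connEvent ends s t)ᶜ).indicator 1 ω) ≤
    expect p (fun ω => F (cluster ends ω s) (cluster ends ω t) *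
        G (cluster ends ω s) (cluster ends ω t) * ((connEvent ends s t)ᶜ).indicator 1 ω) *
      prob p (connEvent ends s t)ᶜ := by
  have key := merged_union_pa ends s t ∅ ∅ hp (Set.notMem_empty t) hpt hF hG hF0 hG0 hFM hGM
  simp only [merged_empty_right, setOf_notMem_cluster_eq] at key
  exact key

end BHK

end MergedU

end Summit.Ventures.PercRepro2
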